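import Summits.BirchSwinnertonDyer.BirchSwinnertonDyer.Theorems.PrintCFramBottomClassIndexLawFiveLeSelmerCountCharacterSupply
import Summits.BirchSwinnertonDyer.BirchSwinnertonDyer.Theorems.PrintCFramBottomClassIndexLawFiveLeKummerTwoCharacters
import Summits.BirchSwinnertonDyer.BirchSwinnertonDyer.Theorems.PrintCFramBottomClassIndexLawFiveLeKummerEigenclassOfComponent
import HarnessLib

/-!
# Route `PrintCFram`, crux C2 `BottomClassIndexLawFiveLe` (stmt-BirchSwinnertonDyer-20372), line
# `eisenstein-resource-bdp-line` (registry v21, stubs B1-level `stub_bsdp_of_level` / B1-sha `stub_bsdp_of_sha`):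
# **(LA) ∧ EVEN-IRREGULAR ⟹ `Ш(W/ℚ)[p] ≠ 0`** — the B1-sha branch of the first-order Selmer census, assembled: w7 g4's two
# independent Kummer characters (`KummerRadical.exists_two_independent_kummer_characters`, p684186) fed to this seat's character
# supply count (`SelmerCount.exists_sha_ne_zero_of_forall_exists_adaptedRoot_of_two_characters_of_cmRamified`, p684559)
# (cell `bsd-print-cfram`, width seat `bsd-line-cfram-p1-w2` g11; helper `--supports` 20372; 0 defs, 0 facts, 0 sorry;
# CONDITIONAL on the tree's named fact `localEulerPoincareCharacteristic ℚ_v` exactly as `…SelmerCountCoalignedOfLocal`)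

HONEST FRAMING. Nothing about BSD is proved here and no stub is closed. This file is ONE composition. Its content for the line
(seat notes w2g8 §4, w2g9, w2g10 §1/§5, w7g4; LEAD g12 dossier §5 «B1-sha's premise can only hold on CASE R ∧ EVEN-IRREGULAR members;
what is missing there is a character supply»): on the CM-ramified rank-one class, a member `W` whose stable line `Φ` (character `θ`)
satisfies w6 g4's local condition (LA) at `p` («CASE R» when `Φ` is the odd line), and whose reflection field `K` (CM, Galois, `∋ ζ_p`,
`p ∤ [K:ℚ]`, `θ` trivial on `Γ_K`) carries an EVEN character `θ_K ≡ e` with the REFLECTION CONDITION `ā·ē⁻¹ ≡ θ` and a non-trivial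
`e`-eigenclass in `Cl(𝓞 K)[p]` (EVEN-IRREGULARITY: `e_{θ_K}(Cl_K)[p] ≠ 0`), has `Ш(W/ℚ)[p] ≠ 0` — granted Milne's local Euler
characteristic (named fact, as in p681509). Chain: Herbrand's `θ_K`-unit and the class radical of `x` (w7 g4 L1/L3) ⟹ two admissible
independent `ā ē⁻¹`-isotypic Kummer characters of `Γ_K` (w7 g4 K1/K2/L3.5) ⟹ (reflection condition) `θ`-isotypic ⟹ `#R_rel(Φ) =
#h1Unramified Φ.Sub S_p ≥ p²` (this seat, p684559, through w2 g10's reverse bridge p682362) ⟹ with (LA) ⟹ CO-ALIGNED (w2 g10 p681509,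
Tate local Euler characteristic) ⟹ `R_rel(Φ) ↪ Sel_p(W/ℚ)`, `#Sel_p ≥ p²`, rank 1 ⟹ `Ш(W/ℚ)[p] ≠ 0` (w2 g10 p679505).

* §1 `multiplicative_pow_congr` — exponents of an element of `Multiplicative (ℤ/p)` only matter modulo `p` (converts w7 g4's isotypy
  exponent `a γ̄ · e γ̄⁻¹` into the bridge's `(θ γ).val` under the reflection condition).
* §2 **`exists_sha_ne_zero_of_forall_exists_adaptedRoot_of_evenEigenclass_of_cmRamified`** — the statement above, hypotheses of
  p684559 §4 (class, (LA), `θ`, `K`, `hpK`, `hrK`) and of p684186 (`hζ`, `a`, `ha`, `θ_K` even `≠ 1`, `θ_K ≡ e`, eigenclass `x`) VERBATIM,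
  plus the reflection condition `((a γ̄ * e γ̄⁻¹ : ℕ) : ZMod p) = θ γ`.

READING (B1-sha): with `Φ` the odd line `𝔽_p(ψ)` of the model `W_ψ`, `K = K'` the CM field cut out by `ψ̄` and `ω̄` (w6 g3
`LevelDictionaryAlpha.exists_cmField_of_character`), `a = ω̄`, `θ_K = Teich(ω̄ψ̄⁻¹) = θ_e` (so `ā ē⁻¹ = ψ̄ = θ` — the reflection condition
holds identically): **CASE R ∧ «θ_e IRREGULAR at K'» ⟹ `Ш(W_ψ)[p] ≠ 0`**, the exact complement of w4 g10's
`natCard_selmerGroup_le_sq_of_evenRegularClassGroup` / w2 g10's `…_of_evenRegular` («θ_e REGULAR ⟹ `Ш(W)[p] = 0`») on CASE R members.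
What this does NOT do: prove `BSD_p` for these members (that is the registered stub `stub_bsdp_of_sha` — BKNO 2026 §1.4's deferred
reciprocity law); discharge `localEulerPoincareCharacteristic`; produce the eigenclass `x` from a class-NUMBER statement
(`classGroupChiCard ≠ 1 ⟹ ∃ x`, w7 g4's «dictionary run backwards», not yet in the tree).

THEOREMS ONLY; no definition, no named fact, no `sorry`. BSD is not proved by any of this; no summit statement is proved by this seat.
References: [Washington1997] §10.2 (Thm. 10.9 and its proof: Leopoldt's Spiegelungssatz); [MilneADT2006] I Thm. 2.8;
[SerreGaloisCohomology1997] I.§2.6 (b); [SilvermanAEC2009] X.§4; seat notes w2g10 §5, w7g4.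
-/

set_option autoImplicit false
-- `…BirchSwinnertonDyer.BirchSwinnertonDyer.Theorems…` is the problem's mandated namespace (D-0017).
set_option linter.dupNamespace false

noncomputable section

open scoped Classical

namespace Summit.BirchSwinnertonDyer.BirchSwinnertonDyer.Theorems.PrintCFram.SelmerCount

open NumberField IsDedekindDomain Field WeierstrassCurve
open Literature.NumberTheory.EllipticCurves Literature.NumberTheory.GaloisRepresentations
  Literature.NumberTheory.EllipticCurves.GreenbergSelmer Literature.NumberTheory.EllipticCurves.Rank1Residual
  Literature.NumberTheory.NumberFields
open Summit.BirchSwinnertonDyer.Rank1Residual.X2.ResidualDevissageModules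

/-! ## §1 Glue: exponents modulo `p` -/

section Glue

variable {p : ℕ}

/-- Exponents of an element of `Multiplicative (ℤ/p)` only matter modulo `p`. [folklore] -/
theorem multiplicative_pow_congr {x : Multiplicative (ZMod p)} {m n : ℕ} (h : (m : ZMod p) = n) : x ^ m = x ^ n := by
  rw [← ofAdd_toAdd x, ← ofAdd_nsmul, ← ofAdd_nsmul, nsmul_eq_mul, nsmul_eq_mul, h]

end Glue

/-! ## §2 (LA) ∧ EVEN-IRREGULAR ⟹ `Ш(W/ℚ)[p] ≠ 0` on the CM-ramified class -/

section Class

variable (W : WeierstrassCurve ℚ) [W.IsElliptic] [W.IsGloballyMinimal]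
variable {p : ℕ} [hp : Fact p.Prime]

/-- **(LA) ∧ EVEN-IRREGULAR ⟹ `Ш(W/ℚ)[p] ≠ 0` ON THE CM-RAMIFIED CLASS, granted the local Euler characteristic.** `W/ℚ` globally
minimal with CM, `p ≥ 5` ramified in the CM field (so `p ∈ {7, 11, 19, 43, 67, 163}`), `rank W(ℚ) = 1`; `v ∋ p`; `Φ ≤ W[p]` a stable line
of order `p` on which `Γ_ℚ` acts through `θ : Γ_ℚ →* 𝔽_pˣ`, satisfying w6 g4's (LA): every `P ∈ W(ℚ_v)` has a `Φ`-adapted `p`-th root;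
`K` a CM field, Galois over `ℚ`, `p ∤ [K:ℚ]`, `θ(res Γ_K) = 1`, with a primitive `p`-th root of unity `ζ`, `σ₀ ζ = ζ^{a σ₀}`; `θ_K :
Gal(K/ℚ) →* ℤ_pˣ` EVEN, `≠ 1`, `θ_K ≡ e (mod p)`, satisfying the REFLECTION CONDITION `a(γ̄)·e(γ̄⁻¹) ≡ θ(γ) (mod p)` for all
`γ ∈ Γ_ℚ`; `x ∈ Cl(𝓞 K)` an `e`-eigenclass with `x ≠ 1`, `x^p = 1` (EVEN-IRREGULARITY); ASSUME `localEulerPoincareCharacteristic ℚ_v`.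
THEN **`∃ c ∈ Ш(W/ℚ), c ≠ 0 ∧ p • c = 0`**. Proof: w7 g4's `KummerRadical.exists_two_independent_kummer_characters` (Herbrand unit +
class radical) gives two admissible independent characters with the isotypy exponent `a γ̄·e γ̄⁻¹`; the reflection condition turns it
into `(θ γ).val` (§1); then `exists_sha_ne_zero_of_forall_exists_adaptedRoot_of_two_characters_of_cmRamified`. Conditional only on the
named fact `localEulerPoincareCharacteristic` (Milne I 2.8). [cite: Washington1997, §10.2 (Thm. 10.9)] [cite: MilneADT2006, Ch. I §2 Thm. 2.8]
[cite: SilvermanAEC2009, Thm. X.4.2] -/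
theorem exists_sha_ne_zero_of_forall_exists_adaptedRoot_of_evenEigenclass_of_cmRamified
    (hCM : W.HasCM) (hram : CMRamified W p) (h5 : 5 ≤ p) (hrank : W.mordellWeilRank = 1)
    {v : HeightOneSpectrum (𝓞 ℚ)} (hpv : ((p : ℕ) : 𝓞 ℚ) ∈ v.asIdeal)
    (hEP : localEulerPoincareCharacteristic (v.adicCompletion ℚ))
    (Φ : StableSubgroup (absoluteGaloisGroup ℚ) (geomTorsion W (p : ℤ))) (hcard : Nat.card Φ.Sub = p)
    (hLA : ∀ P : (W.baseChange (v.adicCompletion ℚ)).toAffine.Point,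
      ∃ R : localPoints W (v.adicCompletion ℚ),
        (p : ℤ) • R = Affine.Point.map (W' := W)
          (IsScalarTower.toAlgHom ℚ (v.adicCompletion ℚ) (AlgebraicClosure (v.adicCompletion ℚ))) P ∧
        ∀ σ : absoluteGaloisGroup (v.adicCompletion ℚ), ∃ t ∈ Φ.toAddSubgroup,
          σ • R - R = pointsMap W (v.adicCompletion ℚ) (t : geomPoints W))
    (θ : absoluteGaloisGroup ℚ →* (ZMod p)ˣ)
    (hθ : ∀ (g : absoluteGaloisGroup ℚ) (s : Φ.Sub), g • s = (((θ g : ZMod p).val : ℕ) : ℤ) • s)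
    {K : Type} [Field K] [NumberField K] [IsCMField K] [IsGalois ℚ K] (hpK : ¬ p ∣ Module.finrank ℚ K)
    (hrK : ∀ σ : absoluteGaloisGroup K, θ (absGaloisRestrict ℚ K σ) = 1)
    {ζ : K} (hζ : IsPrimitiveRoot ζ p) (a : (K ≃ₐ[ℚ] K) → ℕ) (ha : ∀ σ₀ : K ≃ₐ[ℚ] K, σ₀ ζ = ζ ^ a σ₀)
    (θK : (K ≃ₐ[ℚ] K) →* ℤ_[p]ˣ) (hθK1 : θK ≠ 1) (hθKc : θK ((IsCMField.complexConj K).restrictScalars ℚ) = 1)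
    (e : (K ≃ₐ[ℚ] K) → ℕ) (hθKe : ∀ σ : K ≃ₐ[ℚ] K, ‖((θK σ : ℤ_[p]ˣ) : ℤ_[p]) - (e σ : ℤ_[p])‖ < 1)
    (hrefl : ∀ γ : absoluteGaloisGroup ℚ,
      ((a (absGaloisQuot ℚ K γ) * e (absGaloisQuot ℚ K γ)⁻¹ : ℕ) : ZMod p) = ((θ γ : (ZMod p)ˣ) : ZMod p))
    (x : ClassGroup (𝓞 K)) (hx1 : x ≠ 1) (hxp : x ^ p = 1)
    (hxe : ∀ σ : K ≃ₐ[ℚ] K, classGroupRep ℚ K σ (Additive.ofMul x) = e σ • Additive.ofMul x) :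
    ∃ c ∈ W.sha, c ≠ 0 ∧ p • c = 0 := by
  obtain ⟨κ₁, κ₂, ⟨ho₁, hu₁, he₁⟩, ⟨ho₂, hu₂, he₂⟩, hind⟩ :=
    KummerRadical.exists_two_independent_kummer_characters hpK hζ a ha θK hθK1 hθKc e hθKe x hx1 hxp hxe
  have hrefl' : ∀ γ : absoluteGaloisGroup ℚ,
      ((a (absGaloisQuot ℚ K γ) * e (absGaloisQuot ℚ K γ)⁻¹ : ℕ) : ZMod p) =
        ((((θ γ : (ZMod p)ˣ) : ZMod p).val : ℕ) : ZMod p) := fun γ => by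
    rw [hrefl γ, ZMod.natCast_zmod_val]
  exact exists_sha_ne_zero_of_forall_exists_adaptedRoot_of_two_characters_of_cmRamified W hCM hram h5 hrank hpv hEP Φ hcard
    hLA θ hθ hpK hrK κ₁ κ₂ ho₁ ho₂ hu₁ hu₂ (fun γ σ => by rw [he₁ γ σ]; exact multiplicative_pow_congr (hrefl' γ))
    (fun γ σ => by rw [he₂ γ σ]; exact multiplicative_pow_congr (hrefl' γ)) hind

/-! ## §3 (appended, w2 g11) The same in the REFLECTION-PAIR currency of p682218 / w4 g10: EVEN-IRREGULAR as `#e_{ω∘ψ̄}(ℤ_p ⊗ Cl K) ≠ 1` -/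

/-- **CASE R ∧ EVEN-IRREGULAR ⟹ `Ш(W/ℚ)[p] ≠ 0`, class-group-component currency (granted the local Euler characteristic).** Class member
`W/ℚ` (globally minimal, CM, `CMRamified W p`, `p ≥ 5`) of rank one; `v ∋ p`; `Φ ≤ W[p]` a stable line of order `p` with character
`θ : Γ_ℚ →* 𝔽_pˣ` satisfying w6 g4's (LA) at `v`; `K` a CM field, Galois over `ℚ`, `p ∤ [K:ℚ]`, `θ(res Γ_K) = 1`, `ζ ∈ K` a primitive `p`-th
root of unity with `σ ζ = ζ^{a σ}`; `χ̄ : Gal(K/ℚ) →* 𝔽_pˣ` the DESCENT of `θ` (`χ̄(γ̄) = θ(γ)`), ODD (`χ̄(c) = −1`), and `ψ̄` its reflection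
(`ψ̄ σ = a σ · χ̄(σ)⁻¹`, i.e. `ω̄ θ⁻¹`, even), `ψ̄ ≠ 1`; and EVEN-IRREGULARITY **`#e_{ω∘ψ̄}(ℤ_p ⊗ Cl(𝓞 K)) ≠ 1`** (`classGroupChiCard` of the
Teichmüller lift of `ψ̄` — EXACTLY the quantity bounding `#R_rel` from above in w7 g4's
`SelmerCountClassSide.natCard_h1Unramified_le_prime_mul_classGroupChiCard_of_odd_character`, p682218, and set to `1` in w4 g10's
`natCard_selmerGroup_le_sq_of_evenRegularClassGroup`). THEN **`∃ c ∈ Ш(W/ℚ), c ≠ 0 ∧ p • c = 0`** — w7 g4's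
`KummerRadical.exists_two_independent_kummer_characters_of_odd_character` (component ⟹ eigenclass ⟹ Herbrand unit + class radical ⟹ two
independent admissible `χ̄`-isotypic characters) fed to `exists_sha_ne_zero_of_forall_exists_adaptedRoot_of_two_characters_of_cmRamified`.
So on CASE R members the first-order census is a DICHOTOMY in the kernel: `#e_{θ_e} = 1 ⟹ Ш(W)[p] = 0` (w2 g10 / w4 g10, mod CT + GZK),
`#e_{θ_e} ≠ 1 ⟹ Ш(W)[p] ≠ 0` (this theorem, mod Milne I 2.8). [cite: Washington1997, §10.2 (Thm. 10.9)] [cite: MilneADT2006, Ch. I §2 Thm. 2.8]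
[cite: SilvermanAEC2009, Thm. X.4.2] -/
theorem exists_sha_ne_zero_of_forall_exists_adaptedRoot_of_classGroupChiCard_ne_one_of_cmRamified
    (hCM : W.HasCM) (hram : CMRamified W p) (h5 : 5 ≤ p) (hrank : W.mordellWeilRank = 1)
    {v : HeightOneSpectrum (𝓞 ℚ)} (hpv : ((p : ℕ) : 𝓞 ℚ) ∈ v.asIdeal)
    (hEP : localEulerPoincareCharacteristic (v.adicCompletion ℚ))
    (Φ : StableSubgroup (absoluteGaloisGroup ℚ) (geomTorsion W (p : ℤ))) (hcard : Nat.card Φ.Sub = p)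
    (hLA : ∀ P : (W.baseChange (v.adicCompletion ℚ)).toAffine.Point,
      ∃ R : localPoints W (v.adicCompletion ℚ),
        (p : ℤ) • R = Affine.Point.map (W' := W)
          (IsScalarTower.toAlgHom ℚ (v.adicCompletion ℚ) (AlgebraicClosure (v.adicCompletion ℚ))) P ∧
        ∀ σ : absoluteGaloisGroup (v.adicCompletion ℚ), ∃ t ∈ Φ.toAddSubgroup,
          σ • R - R = pointsMap W (v.adicCompletion ℚ) (t : geomPoints W))
    (θ : absoluteGaloisGroup ℚ →* (ZMod p)ˣ)
    (hθ : ∀ (g : absoluteGaloisGroup ℚ) (s : Φ.Sub), g • s = (((θ g : ZMod p).val : ℕ) : ℤ) • s)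
    {K : Type} [Field K] [NumberField K] [IsCMField K] [IsGalois ℚ K] (hpK : ¬ p ∣ Module.finrank ℚ K)
    (hrK : ∀ σ : absoluteGaloisGroup K, θ (absGaloisRestrict ℚ K σ) = 1)
    {ζ : K} (hζ : IsPrimitiveRoot ζ p) (a : (K ≃ₐ[ℚ] K) → ℕ) (ha : ∀ σ₀ : K ≃ₐ[ℚ] K, σ₀ ζ = ζ ^ a σ₀)
    (χb : (K ≃ₐ[ℚ] K) →* (ZMod p)ˣ) (hχb : ∀ γ : absoluteGaloisGroup ℚ, χb (absGaloisQuot ℚ K γ) = θ γ)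
    (hoddχ : χb ((IsCMField.complexConj K).restrictScalars ℚ) = -1)
    (ψb : (K ≃ₐ[ℚ] K) →* (ZMod p)ˣ) (hψb1 : ψb ≠ 1)
    (hψb : ∀ σ : K ≃ₐ[ℚ] K, ((ψb σ : (ZMod p)ˣ) : ZMod p) = (a σ : ZMod p) * (((χb σ)⁻¹ : (ZMod p)ˣ) : ZMod p))
    (hne : classGroupChiCard ℚ K p (fun g => ((((Kato2004.teichmullerChar p).comp ψb) g : ℤ_[p]ˣ) : ℤ_[p])) ≠ 1) :
    ∃ c ∈ W.sha, c ≠ 0 ∧ p • c = 0 := by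
  obtain ⟨κ₁, κ₂, ⟨ho₁, hu₁, he₁⟩, ⟨ho₂, hu₂, he₂⟩, hind⟩ :=
    KummerRadical.exists_two_independent_kummer_characters_of_odd_character hpK hζ a ha χb hoddχ ψb hψb1 hψb hne
  exact exists_sha_ne_zero_of_forall_exists_adaptedRoot_of_two_characters_of_cmRamified W hCM hram h5 hrank hpv hEP Φ hcard
    hLA θ hθ hpK hrK κ₁ κ₂ ho₁ ho₂ hu₁ hu₂ (fun γ σ => by rw [he₁ γ σ, hχb]) (fun γ σ => by rw [he₂ γ σ, hχb]) hind

end Class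

end Summit.BirchSwinnertonDyer.BirchSwinnertonDyer.Theorems.PrintCFram.SelmerCount

end
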